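import Literature.AlgebraicGeometry.Resolution.LipmanValuativeQuadraticSequenceProofs
import Literature.AlgebraicGeometry.Resolution.BlowupStalkCharts
import Literature.AlgebraicGeometry.Resolution.RegularCentreBlowupOrder
import Literature.AlgebraicGeometry.Resolution.BlowupChartRsop
import Literature.AlgebraicGeometry.Resolution.BlowupDimension
import Literature.AlgebraicGeometry.Resolution.GenericPointStalkData
import Literature.AlgebraicGeometry.Resolution.StalkIdealLemmas
import Literature.AlgebraicGeometry.Motives.SubschemeCyclesRatStalkProofs
import HarnessLib

/-!
# The axial point of a blowing up: the point over `P` in the chart of a chosen parameter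

Topic: `Literature/AlgebraicGeometry/Resolution`. Let `X` be an integral, locally Noetherian
scheme, `P ∈ X` a point whose local ring `𝒪_{X,P}` is regular with a regular system of
parameters `(t, y₁, …, y_n)` (`t = c 0`, `yᵢ = c i.succ`), and `π : X' → X` a blowing up of `X`
along the reduced closed subscheme `cl{P}` (universal property, `IsBlowup`). Stacks 0804 describes
`X'` over `Spec 𝒪_{X,P}` by the charts `Spec 𝒪_{X,P}[𝔪/c_j]`; in the chart of `t` the closed point
"`t, y/t`" (all ratios `yᵢ/t` vanish) is the point where the strict transform of the curve
`{y = 0}` through `P` meets the exceptional divisor — the centre of the NEXT blow-up in a test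
sequence of point blow-ups along an axis (Hironaka's type-(I) sequences; Cossart–Piltant's
"near points" read at generic points; Lipman's quadratic sequence along a valuation).

PROVED here (`exists_axialPoint`): **there is a point `x' ∈ X'` over `P` together with a ring
homomorphism `ψ : 𝒪_{X,P} → 𝒪_{X',x'}` computing the stalks of all pulled-back ideal sheaves
(`(π^*K)_{x'} = K_P · 𝒪_{X',x'}`, i.e. `ψ` is the stalk map) and a regular system of parameters
`(t', y'₁, …, y'_n)` of the regular local ring `𝒪_{X',x'}` with `t' = ψ(t)` (local equation of the
exceptional divisor) and `ψ(yᵢ) = t' · y'ᵢ`; moreover `dim 𝒪_{X',x'} = dim 𝒪_{X,P}`**; and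
(`isClosed_singleton_axialPoint`) **if `P` is a closed point then so is every point over `P` of
the same local dimension**, in particular `x'`.

Assembled from the tree: the chart morphism `Spec 𝒪_{X,P}[𝔪/t] → X'` (`IsBlowup.exists_chart_morphism_of_index`,
blowing ups commute with the flat base change `Spec 𝒪_{X,P} → X`), its stalk dictionary
(`exists_stalk_ringHom_of_chart`), the reduction of the chart modulo `𝔪`
(`exists_chartResidueMap`: `𝒪_{X,P}[𝔪/t]/𝔪 ≅ κ(P)[T₁, …, T_n]`, the prime is `T = 0`), the regular
system of parameters of the local rings of the chart (`isRsopPart_chartFamily_reesChart`, de Jong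
2.4 / Stacks 0BIQ), and the dimension bound `dim 𝒪_{X',x'} ≤ dim 𝒪_{X,P}` (`IsBlowup.ringKrullDim_stalk_le`).

## Sources

* The Stacks Project, Tag 0804 (affine charts of a blowing up), Tag 0BIQ, Tag 01J7.
  [StacksProject]
* A. J. de Jong, Publ. Math. IHÉS 83 (1996), 2.4. [DeJong1996]
* V. Cossart, O. Piltant, J. Algebra 320 (2008), proof of Prop. 4.2, (10)–(11). [CossartPiltant2008]
-/

noncomputable section

open CategoryTheory AlgebraicGeometry TopologicalSpace IsLocalRing

namespace Literature.AlgebraicGeometry.Resolution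

universe u

open Scheme.IdealSheafData

variable {X' X : Scheme.{u}} {π : X' ⟶ X}

/-! ## Dimension bookkeeping for a regular system of parameters -/

/-- If `c : Fin m → R` is part of a regular system of parameters and already generates `𝔪`, then
`dim R = m`. [cite: Matsumura1987, Thm. 14.2] -/
private theorem ringKrullDim_eq_of_isRsopPart_of_span_eq {R : Type u} [CommRing R] [IsLocalRing R]
    {m : ℕ} {c : Fin m → R} (hreg : IsRsopPart c)
    (hc : Ideal.span (Set.range c) = maximalIdeal R) : ringKrullDim R = (m : ℕ) := by
  haveI := hreg.isRegularLocalRing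
  have h := hreg.ringKrullDim_quotient_add
  rw [hc] at h
  haveI : IsField (R ⧸ maximalIdeal R) := Ideal.Quotient.maximal_ideal_iff_isField_quotient _ |>.mp
    inferInstance
  rw [ringKrullDim_eq_zero_of_isField this, zero_add] at h
  exact h.symm

/-- In that situation the embedding dimension is `m` as well. [cite: Matsumura1987, Thm. 14.2] -/
private theorem spanFinrank_eq_of_isRsopPart_of_span_eq {R : Type u} [CommRing R] [IsLocalRing R]
    {m : ℕ} {c : Fin m → R} (hreg : IsRsopPart c)
    (hc : Ideal.span (Set.range c) = maximalIdeal R) : (maximalIdeal R).spanFinrank = m := by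
  haveI := hreg.isRegularLocalRing
  have h1 := IsRegularLocalRing.spanFinrank_maximalIdeal (R := R)
  rw [ringKrullDim_eq_of_isRsopPart_of_span_eq hreg hc] at h1
  exact_mod_cast h1

/-- Conversely, a part `c : Fin m → R` of a regular system of parameters of a ring of dimension
`≤ m` generates `𝔪`. [cite: Matsumura1987, Thm. 14.2] -/
private theorem span_eq_of_isRsopPart_of_ringKrullDim_le {R : Type u} [CommRing R] [IsLocalRing R]
    {m : ℕ} {c : Fin m → R} (hreg : IsRsopPart c) (hdim : ringKrullDim R ≤ (m : ℕ)) :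
    Ideal.span (Set.range c) = maximalIdeal R := by
  obtain ⟨_, e, y, hdim', hspan⟩ := hreg
  have he : e = 0 := by
    rw [hdim'] at hdim
    have : m + e ≤ m := by exact_mod_cast hdim
    omega
  subst he
  rw [← hspan]
  congr 1
  ext a
  simp only [Set.mem_range, Set.mem_union, iff_self_or]
  rintro ⟨i, -⟩
  exact i.elim0

/-! ## The prime `(t, y/t)` of the chart ring -/

section Chart

variable {R : Type u} [CommRing R] [IsLocalRing R] {n : ℕ} (c : Fin (n + 1) → R)

/-- **The axial prime of the chart ring at `t = c 0`**: for a quasi-regular `c` in `𝔪`, there is a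
prime `𝔴` of `B = (R[𝔪t])_{(t·T)} = R[𝔪/t]` lying over `𝔪` and containing all the ratios
`e_i = yᵢ/t` (`i ≠ 0`) — the kernel of `B → B/𝔪B ≅ κ[T₁, …, T_n] → κ`, `T ↦ 0`.
[cite: StacksProject, Tag 0804] -/
theorem exists_axialPrime (hcq : IsQuasiRegular c) (hcm : ∀ l, c l ∈ maximalIdeal R) :
    ∃ 𝔴 : Ideal (chartRing c 0), 𝔴.IsPrime ∧ 𝔴.comap (chartBase c 0) = maximalIdeal R ∧
      ∀ i : Fin n, chartGen c 0 i.succ ∈ 𝔴 := by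
  classical
  obtain ⟨ρ, hρsurj, hρker, hρF⟩ := exists_chartResidueMap c 0 hcq hcm
  let θ : chartRing c 0 →+* R ⧸ maximalIdeal R :=
    (MvPolynomial.eval fun _ => (0 : R ⧸ maximalIdeal R)).comp ρ
  refine ⟨RingHom.ker θ, RingHom.ker_isPrime θ, ?_, fun i => ?_⟩
  · refine (IsLocalRing.maximalIdeal.isMaximal R).eq_of_le ?_ ?_ |>.symm
    · rw [Ne, Ideal.comap_eq_top_iff]
      exact (RingHom.ker_isPrime θ).ne_top
    · intro a ha
      rw [Ideal.mem_comap, RingHom.mem_ker]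
      have : chartBase c 0 a ∈ RingHom.ker ρ := by
        rw [hρker]; exact Ideal.mem_map_of_mem _ ha
      rw [RingHom.mem_ker] at this
      change MvPolynomial.eval _ (ρ (chartBase c 0 a)) = 0
      rw [this, map_zero]
  · rw [RingHom.mem_ker]
    change MvPolynomial.eval _ (ρ (chartGen c 0 i.succ)) = 0
    have h := hρF (MvPolynomial.X i.succ)
    rw [MvPolynomial.coe_eval₂Hom, MvPolynomial.eval₂_X] at h
    rw [h, MvPolynomial.aeval_X, killVar_of_ne 0 (Fin.succ_ne_zero i), MvPolynomial.map_X,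
      MvPolynomial.eval_X]

end Chart

/-! ## Transport of stalks along an equality of points -/

/-- `K_x = K_y · 𝒪` along the canonical identification of stalks at equal points. [folklore] -/
private theorem stalkIdeal_eq_map_stalkCongr_inv {x y : X} (h : x = y) (K : X.IdealSheafData) :
    stalkIdeal K x = (stalkIdeal K y).map (X.presheaf.stalkCongr (.of_eq h)).inv.hom := by
  subst h
  simp only [TopCat.Presheaf.stalkCongr_inv, TopCat.Presheaf.stalkSpecializes_refl,
    CommRingCat.hom_id, Ideal.map_id]

/-! ## The axial point -/

/-- **The axial point of a blowing up.** Let `X` be integral and locally Noetherian, `P ∈ X` with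
`𝒪_{X,P}` regular and `c = (t, y₁, …, y_n)` a regular system of parameters (`c 0 = t`), and
`π : X' → X` a blowing up along the reduced closed subscheme `cl{P}` (so `𝓘_P = 𝔪_P`). Then there
are a point `x' ∈ X'` over `P`, a ring homomorphism `ψ : 𝒪_{X,P} → 𝒪_{X',x'}` with
`(π^* K)_{x'} = ψ(K_P) · 𝒪_{X',x'}` for every quasi-coherent ideal `K` of `𝒪_X` (the stalk map),
and a regular system of parameters `c' = (t', y'₁, …, y'_n)` of `𝒪_{X',x'}` (part of one and
generating `𝔪_{x'}`) with `t' = ψ(t)` and `ψ(yᵢ) = t' y'ᵢ` — the point "`(t, y/t)`" of the chart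
`Spec 𝒪_{X,P}[𝔪/t]` (Stacks 0804); and `dim 𝒪_{X',x'} = dim 𝒪_{X,P}`.
[cite: StacksProject, Tag 0804] [cite: DeJong1996, 2.4] -/
theorem exists_axialPoint [IsIntegral X] [IsLocallyNoetherian X] (P : X) {n : ℕ}
    (c : Fin (n + 1) → X.presheaf.stalk P)
    (hc : Ideal.span (Set.range c) = maximalIdeal (X.presheaf.stalk P)) (hreg : IsRsopPart c)
    (hπ : IsBlowup π (vanishingIdeal ⟨closure {P}, isClosed_closure⟩)) :
    ∃ (x' : X') (_ : π x' = P) (ψ : X.presheaf.stalk P →+* X'.presheaf.stalk x')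
      (c' : Fin (n + 1) → X'.presheaf.stalk x'),
      (∀ K : X.IdealSheafData, stalkIdeal (K.comap π) x' = (stalkIdeal K P).map ψ) ∧
      IsRsopPart c' ∧ Ideal.span (Set.range c') = maximalIdeal (X'.presheaf.stalk x') ∧
      c' 0 = ψ (c 0) ∧ (∀ i : Fin n, ψ (c i.succ) = c' 0 * c' i.succ) ∧
      ringKrullDim (X'.presheaf.stalk x') = ringKrullDim (X.presheaf.stalk P) := by
  classical
  haveI : IsRegularLocalRing (X.presheaf.stalk P) := hreg.isRegularLocalRing
  -- the centre's stalk at `P` is `𝔪_P = (c)`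
  have hJ : stalkIdeal (vanishingIdeal ⟨closure {P}, isClosed_closure⟩) P =
      maximalIdeal (X.presheaf.stalk P) := stalkIdeal_vanishingIdeal_closure_self P
  have hcJ : Ideal.span (Set.range c) =
      stalkIdeal (vanishingIdeal ⟨closure {P}, isClosed_closure⟩) P := hc.trans hJ.symm
  -- regular system of parameters bookkeeping
  have hd : (maximalIdeal (X.presheaf.stalk P)).spanFinrank = n + 1 :=
    spanFinrank_eq_of_isRsopPart_of_span_eq hreg hc
  have hdimP : ringKrullDim (X.presheaf.stalk P) = (n + 1 : ℕ) :=
    ringKrullDim_eq_of_isRsopPart_of_span_eq hreg hc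
  have hcq : IsQuasiRegular c := isQuasiRegular_regularSystemOfParameters hd c hc
  have hcm : ∀ l, c l ∈ maximalIdeal (X.presheaf.stalk P) := fun l =>
    hc ▸ Ideal.subset_span ⟨l, rfl⟩
  -- the chart at `t = c 0` and its axial prime
  obtain ⟨q, hqiso, hsq⟩ := hπ.exists_chart_morphism_of_index P c hcJ 0
  obtain ⟨𝔴, h𝔴prime, h𝔴, hgen𝔴⟩ := exists_axialPrime c hcq hcm
  let w : Spec (.of (chartRing c 0)) := ⟨𝔴, h𝔴prime⟩
  haveI := hqiso w
  -- the point `x' = q 𝔴` lies over `P`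
  have hw : Spec.map (CommRingCat.ofHom (chartBase c 0)) w = closedPoint (X.presheaf.stalk P) :=
    PrimeSpectrum.ext h𝔴
  have hx : π (q w) = P := by
    rw [← Scheme.Hom.comp_apply, hsq, Scheme.Hom.comp_apply, hw]
    exact Scheme.fromSpecStalk_closedPoint
  refine ⟨q w, hx, ?_⟩
  set x' : X' := q w with hx'def
  -- transport of the base stalk along `π x' = P`
  let e : X.presheaf.stalk (π x') ≅ X.presheaf.stalk P := X.presheaf.stalkCongr (.of_eq hx)
  have he : Spec.map e.hom ≫ X.fromSpecStalk (π x') = X.fromSpecStalk P :=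
    Scheme.SpecMap_stalkSpecializes_fromSpecStalk (Inseparable.of_eq hx).ge
  have hsq' : q ≫ π = Spec.map (e.hom ≫ CommRingCat.ofHom (chartBase c 0)) ≫ X.fromSpecStalk (π x') := by
    rw [Spec.map_comp, Category.assoc, he]
    exact hsq
  -- the stalk dictionary: `𝒪_{X', x'} = B_𝔴` with `χ ∘ φ = π^#`
  obtain ⟨χ, hχ, hloc, -⟩ := exists_stalk_ringHom_of_chart π x'
    (e.hom ≫ CommRingCat.ofHom (chartBase c 0)) q w rfl hsq'
  letI := χ.toAlgebra
  haveI : IsLocalization.AtPrime (X'.presheaf.stalk x') 𝔴 := hloc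
  -- the new parameters
  let ψ : X.presheaf.stalk P →+* X'.presheaf.stalk x' := (e.inv ≫ π.stalkMap x').hom
  have hψ : ∀ b, χ (chartBase c 0 b) = ψ b := by
    intro b
    have h := hχ (e.inv.hom b)
    have h2 : e.hom.hom (e.inv.hom b) = b := by
      rw [← CommRingCat.comp_apply, e.inv_hom_id, CommRingCat.id_apply]
    change χ (chartBase c 0 (e.hom.hom (e.inv.hom b))) = _ at h
    rw [h2] at h
    rw [h]
    rfl
  let c' : Fin (n + 1) → X'.presheaf.stalk x' :=
    Fin.cons (χ (chartBase c 0 (c 0))) fun i => χ (chartGen c 0 i.succ)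
  -- they are part of a regular system of parameters: the chart family of `BlowupChartRsop`
  have hz : Ideal.span (Set.range (Fin.append c Fin.elim0)) = maximalIdeal (X.presheaf.stalk P) := by
    have hsurj : Function.Surjective (Fin.cast (Nat.add_zero (n + 1)) : Fin (n + 1 + 0) → Fin (n + 1)) :=
      (finCongr (Nat.add_zero (n + 1))).surjective
    rw [Fin.append_elim0, hsurj.range_comp]
    exact hc
  let jJ : Fin n → {j : Fin (n + 1) // j ≠ 0} := fun k => ⟨k.succ, Fin.succ_ne_zero k⟩
  have hjJ : Function.Injective jJ := fun a b h =>
    Fin.succ_injective _ (congrArg Subtype.val h)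
  have hfam := isRsopPart_chartFamily_reesChart c 0 Fin.elim0 hz (by rw [hd]) 𝔴 h𝔴
    (X'.presheaf.stalk x') jJ hjJ (fun k => hgen𝔴 k)
  have hc'eq : chartFamily c 0 Fin.elim0 (X'.presheaf.stalk x') (chartBase c 0) (chartGen c 0) jJ = c' := by
    funext i
    refine Fin.cases ?_ (fun k => ?_) i
    · simp only [chartFamily, Fin.cons_zero, c']
      rfl
    · simp only [chartFamily, Fin.cons_succ, c']
      rw [Fin.append_right_nil _ _ rfl, Function.comp_apply]
      rfl
  have hreg' : IsRsopPart c' := hc'eq ▸ hfam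
  -- dimension: `dim 𝒪_{X',x'} ≤ dim 𝒪_{X,P} = n + 1`, so `c'` generates `𝔪_{x'}`
  have hle : ringKrullDim (X'.presheaf.stalk x') ≤ (n + 1 : ℕ) := by
    have h := hπ.ringKrullDim_stalk_le x'
    rw [hx] at h
    exact h.trans hdimP.le
  have hspan' : Ideal.span (Set.range c') = maximalIdeal (X'.presheaf.stalk x') :=
    span_eq_of_isRsopPart_of_ringKrullDim_le hreg' hle
  have hdim' : ringKrullDim (X'.presheaf.stalk x') = ringKrullDim (X.presheaf.stalk P) := by
    rw [ringKrullDim_eq_of_isRsopPart_of_span_eq hreg' hspan', hdimP]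
  -- stalks of pulled-back ideals
  have hK : ∀ K : X.IdealSheafData, stalkIdeal (K.comap π) x' = (stalkIdeal K P).map ψ := by
    intro K
    rw [stalkIdeal_comap_eq_map_stalkMap π K x', stalkIdeal_eq_map_stalkCongr_inv hx K, Ideal.map_map]
    rfl
  refine ⟨ψ, c', hK, hreg', hspan', ?_, ?_, hdim'⟩
  · -- `t' = ψ(t)`
    exact hψ (c 0)
  · -- `ψ(yᵢ) = t' · y'ᵢ` from `φ(c_j) = φ(c_0) · e_j` in the chart ring
    intro i
    change ψ (c i.succ) = χ (chartBase c 0 (c 0)) * χ (chartGen c 0 i.succ)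
    rw [← hψ (c i.succ), ← map_mul]
    congr 1
    exact reesChartBase_apply_eq_mul_chartGen c 0 i.succ

/-! ## Closedness -/

/-- **Points of a blowing up over a closed point, of the same local dimension, are closed.** If
`π : X' → X` is a blowing up (of anything) of an integral locally Noetherian scheme, `π x'` is a
closed point, and `dim 𝒪_{X',x'} = dim 𝒪_{X,π x'}`, then `x'` is a closed point: a proper
specialisation `z` of `x'` lies over `π x'` too, and `𝒪_{X',x'}` would be the localisation of
`𝒪_{X',z}` at a non-maximal prime, of dimension `< dim 𝒪_{X',z} ≤ dim 𝒪_{X, π x'}`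
(`IsBlowup.ringKrullDim_stalk_le`). [cite: StacksProject, Tag 01J7] -/
theorem IsBlowup.isClosed_singleton_of_ringKrullDim_eq [IsIntegral X] [IsLocallyNoetherian X]
    [IsLocallyNoetherian X'] {C : X.IdealSheafData} (hπ : IsBlowup π C) {x' : X'}
    (hx : IsClosed ({π x'} : Set X))
    (hdim : ringKrullDim (X'.presheaf.stalk x') = ringKrullDim (X.presheaf.stalk (π x'))) :
    IsClosed ({x'} : Set X') := by
  rw [← closure_subset_iff_isClosed]
  intro z hz
  rw [Set.mem_singleton_iff]
  have hsp : x' ⤳ z := specializes_iff_mem_closure.mpr hz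
  -- `z` lies over `π x'`
  have hπz : π z = π x' := by
    have h := (hsp.map π.continuous).mem_closure
    rwa [hx.closure_eq, Set.mem_singleton_iff] at h
  -- `𝒪_{X',x'}` is the localisation of `𝒪_{X',z}` at `𝔭 = 𝔭_{x'}`
  letI := (X'.presheaf.stalkSpecializes hsp).hom.toAlgebra
  let 𝔭 : Ideal (X'.presheaf.stalk z) :=
    (maximalIdeal (X'.presheaf.stalk x')).comap (X'.presheaf.stalkSpecializes hsp).hom
  haveI : 𝔭.IsPrime := Ideal.comap_isPrime _ _
  haveI : IsLocalization.AtPrime (X'.presheaf.stalk x') 𝔭 :=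
    Literature.AlgebraicGeometry.Motives.isLocalizationAtPrime_stalkSpecializes hsp
  haveI : IsNoetherianRing (X'.presheaf.stalk z) := inferInstance
  have h1 : ringKrullDim (X'.presheaf.stalk x') = 𝔭.height :=
    IsLocalization.AtPrime.ringKrullDim_eq_height 𝔭 (X'.presheaf.stalk x')
  have h2 : ringKrullDim (X'.presheaf.stalk z) ≤ ringKrullDim (X.presheaf.stalk (π x')) := by
    rw [← hπz]; exact hπ.ringKrullDim_stalk_le z
  have h3 : ringKrullDim (X'.presheaf.stalk z) = (maximalIdeal (X'.presheaf.stalk z)).height :=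
    (IsLocalRing.maximalIdeal_height_eq_ringKrullDim).symm
  -- hence `𝔭` is the maximal ideal
  have h𝔭 : 𝔭 = maximalIdeal (X'.presheaf.stalk z) := by
    by_contra hne
    have hlt : 𝔭 < maximalIdeal (X'.presheaf.stalk z) :=
      lt_of_le_of_ne (IsLocalRing.le_maximalIdeal (Ideal.IsPrime.ne_top inferInstance)) hne
    have h4 := Ideal.height_add_one_le_of_lt_of_isPrime hlt
    have hfin : 𝔭.height ≠ ⊤ := Ideal.height_ne_top_of_isPrime
    have h5 : ((maximalIdeal (X'.presheaf.stalk z)).height : WithBot ℕ∞) ≤ 𝔭.height := by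
      rw [← h3, ← h1]; exact h2.trans hdim.symm.le
    have h6 : (maximalIdeal (X'.presheaf.stalk z)).height ≤ 𝔭.height := by exact_mod_cast h5
    have : 𝔭.height + 1 ≤ 𝔭.height := h4.trans h6
    obtain ⟨m, hm⟩ := ENat.ne_top_iff_exists.mp hfin
    rw [← hm] at this
    have : (m + 1 : ℕ) ≤ m := by exact_mod_cast this
    omega
  -- so `z ⤳ x'`, and `z = x'`
  have hzx : z ⤳ x' := by
    have := Literature.AlgebraicGeometry.Motives.eq_of_comap_maximalIdeal_eq (specializes_refl z) hsp ?_
    · exact this ▸ specializes_refl z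
    rw [TopCat.Presheaf.stalkSpecializes_refl]
    change (maximalIdeal _).comap (RingHom.id _) = 𝔭
    rw [Ideal.comap_id, h𝔭]
  exact (hsp.antisymm hzx).eq.symm

/-- **The axial point is closed when `P` is** (with `exists_axialPoint`: `dim 𝒪_{X',x'} = dim 𝒪_{X,P}`).
[cite: StacksProject, Tag 01J7] -/
theorem IsBlowup.isClosed_singleton_axialPoint [IsIntegral X] [IsLocallyNoetherian X]
    {C : X.IdealSheafData} (hπ : IsBlowup π C) {x' : X'} {P : X} (hx : π x' = P)
    (hP : IsClosed ({P} : Set X))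
    (hdim : ringKrullDim (X'.presheaf.stalk x') = ringKrullDim (X.presheaf.stalk P)) :
    IsClosed ({x'} : Set X') := by
  subst hx
  haveI : IsProper π := hπ.isProper
  haveI : IsLocallyNoetherian X' := LocallyOfFiniteType.isLocallyNoetherian π
  exact hπ.isClosed_singleton_of_ringKrullDim_eq hP hdim

end Literature.AlgebraicGeometry.Resolution

end
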